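import Mathlib.Analysis.Calculus.MeanValue
import Mathlib.Algebra.BigOperators.Intervals
import HarnessLib

/-!
# Route A endgame of `stub_modulationBootstrap` (sharp constant): secant sandwich + pointwise Lipschitz susceptibility bound
# (drefute gen-3 by-product for line `uv-thomson-force-wave`, crux `StaticResponseBound`, stmt-AtomisticToContinuum-12057)

Pure real analysis, no physics.  In S3 (`ModulationBootstrap`), with `E(s) = inf_Ψ {E_w(Ψ) + s⟨V_p⟩_Ψ}` and
`b(s) = ⟨V_p⟩_{Φ_s}` the modulation of the positive minimiser at coupling `s` (existence = the lead's hypothesis F1):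
* SECANT bound `E(s″) − E(s) ≤ (s″ − s)·b(s)` (test the infimum at `s″` with `Φ_s`) — for all `s, s″` of the window;
* POINTWISE Lipschitz bound `limsup_{s″→s} |b(s″) − b(s)|/|s″ − s| ≤ 2K` at EVERY `s` of the window — this is the lead's
  two-point lemma `stub_modulationTwoPoint` read at base point `s` (its factor `(1 − 4NC_s|s″−s|)⁻²` tends to `1`; the
  size of the Poincaré constant `C_s` is irrelevant, only its finiteness);
* `b(0) = 0` (translation averaging, `k ≠ 0`).
The theorem below turns exactly these into `E(0) − K t² ≤ E(t)` on the whole window `t² ≤ T` with the SHARP constant `K`: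
the fencing lemma `image_le_of_liminf_slope_right_le_deriv_boundary` upgrades the pointwise bound to `b(u) ≥ −2K·u` on
`[0, √T]` (no uniformity in `s` needed), and a uniform partition with the secant bound gives
`E(t) − E(0) ≥ Σᵢ (t/n)·b((i+1)t/n) ≥ −K t²(1 + 1/n)` for every `n`.  No derivatives of `E`, no FTC.
[folklore: real induction / Dini mean value theorem]
-/

namespace Summit.AtomisticToContinuum.BoseEinsteinCondensation.Theorems.StaticResponseBound.Negative.UvThomsonG3

open Set Filter Topology

/-- From the pointwise Lipschitz bound (constant `2K`, every point of `[0, √T]`-window) and `b 0 = 0`: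
`-(2K) u ≤ b u` for `0 ≤ u`, `u² ≤ T`. [folklore: fencing / real induction] -/
theorem neg_mul_le_of_pointwise_lipschitz {b : ℝ → ℝ} {K T : ℝ}
    (hlip : ∀ s : ℝ, s ^ 2 ≤ T → ∀ ε : ℝ, 0 < ε →
      ∀ᶠ s'' in 𝓝 s, s'' ^ 2 ≤ T → |b s'' - b s| ≤ (2 * K + ε) * |s'' - s|)
    (hb0 : b 0 = 0) {u : ℝ} (hu : 0 ≤ u) (huT : u ^ 2 ≤ T) : -(2 * K * u) ≤ b u := by
  -- window `[0, u]`; every point `x` of it has `x² ≤ T`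
  have hwin : ∀ x ∈ Icc (0 : ℝ) u, x ^ 2 ≤ T := fun x hx => by nlinarith [hx.1, hx.2]
  -- continuity of `-b` on the window
  have hcont : ContinuousOn (fun x => -b x) (Icc 0 u) := by
    intro x hx
    have hx2 := hwin x hx
    have hev := hlip x hx2 1 one_pos
    have : ContinuousWithinAt b (Icc 0 u) x := by
      rw [Metric.continuousWithinAt_iff]
      intro ε hε
      have hM : 0 < 2 * |K| + 2 := by positivity
      obtain ⟨δ, hδ, hδball⟩ := Metric.eventually_nhds_iff.1 hev
      refine ⟨min δ (ε / (2 * |K| + 2)), lt_min hδ (div_pos hε hM), fun y hy hyd => ?_⟩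
      have hyδ : dist y x < δ := lt_of_lt_of_le hyd (min_le_left _ _)
      have hyε : dist y x < ε / (2 * |K| + 2) := lt_of_lt_of_le hyd (min_le_right _ _)
      have hb := hδball hyδ (hwin y hy)
      rw [Real.dist_eq] at hyε ⊢
      have hK1 : 2 * K + 1 ≤ 2 * |K| + 2 := by linarith [le_abs_self K]
      calc |b y - b x| ≤ (2 * K + 1) * |y - x| := hb
        _ ≤ (2 * |K| + 2) * |y - x| := mul_le_mul_of_nonneg_right hK1 (abs_nonneg _)
        _ < (2 * |K| + 2) * (ε / (2 * |K| + 2)) := by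
            rcases eq_or_lt_of_le (abs_nonneg (y - x)) with h0 | hpos
            · rw [← h0, mul_zero]; positivity
            · exact mul_lt_mul_of_pos_left hyε hM
        _ = ε := by field_simp
    exact this.neg
  have key := image_le_of_liminf_slope_right_le_deriv_boundary (f := fun x => -b x) (a := 0) (b := u)
    hcont (B := fun x => 2 * K * x) (B' := fun _ => 2 * K) (by simp [hb0])
    (by fun_prop)
    (fun x _ => by
      have := ((hasDerivWithinAt_id x (Ici x)).const_mul (2 * K))
      simpa using this)
    (fun x hx r hr => by
      -- pointwise Lipschitz at `x` with `ε = (r - 2K)/2` gives eventually `slope (-b) x z < r` on the right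
      have hx2 : x ^ 2 ≤ T := hwin x (Ico_subset_Icc_self hx)
      have hε : 0 < (r - 2 * K) / 2 := by linarith
      have hev := hlip x hx2 _ hε
      have hev' : ∀ᶠ z in 𝓝[>] x, slope (fun x => -b x) x z < r := by
        have h1 : ∀ᶠ z in 𝓝[>] x, z ^ 2 ≤ T → |b z - b x| ≤ (2 * K + (r - 2 * K) / 2) * |z - x| :=
          nhdsWithin_le_nhds hev
        have h2 : ∀ᶠ z in 𝓝[>] x, z ∈ Ioo x u := Ioo_mem_nhdsGT hx.2
        filter_upwards [h1, h2] with z hz1 hz2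
        have hzT : z ^ 2 ≤ T := hwin z ⟨le_trans hx.1 hz2.1.le, hz2.2.le⟩
        have hb := hz1 hzT
        have hzx : 0 < z - x := sub_pos.2 hz2.1
        rw [slope_def_field]
        rw [div_lt_iff₀ hzx]
        have habs : |z - x| = z - x := abs_of_pos hzx
        rw [habs] at hb
        have : -b z - -b x ≤ |b z - b x| := by
          rw [show -b z - -b x = -(b z - b x) by ring]; exact neg_le_abs _
        nlinarith [this, hb, hzx]
      exact hev'.frequently)
  have h : -b u ≤ 2 * K * u := key ⟨hu, le_rfl⟩
  linarith

/-- One-sided Route A endgame (`t > 0`). [folklore] -/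
theorem quadratic_lower_bound_of_secant_pos {E b : ℝ → ℝ} {K T : ℝ} (hK : 0 ≤ K)
    (hsec : ∀ s s'' : ℝ, s ^ 2 ≤ T → s'' ^ 2 ≤ T → E s'' - E s ≤ (s'' - s) * b s)
    (hlip : ∀ s : ℝ, s ^ 2 ≤ T → ∀ ε : ℝ, 0 < ε →
      ∀ᶠ s'' in 𝓝 s, s'' ^ 2 ≤ T → |b s'' - b s| ≤ (2 * K + ε) * |s'' - s|)
    (hb0 : b 0 = 0) {t : ℝ} (ht : 0 < t) (htT : t ^ 2 ≤ T) : E 0 - K * t ^ 2 ≤ E t := by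
  -- for every `n ≥ 1`: `E t - E 0 ≥ -K t² (1 + 1/n)`
  have hstep : ∀ n : ℕ, 0 < n → -(K * t ^ 2 * (1 + 1 / n)) ≤ E t - E 0 := by
    intro n hn
    have hnR : (0 : ℝ) < n := by exact_mod_cast hn
    set sq : ℕ → ℝ := fun i => (i : ℝ) * t / n with hsq
    have hsq0 : sq 0 = 0 := by simp [hsq]
    have hsqn : sq n = t := by simp [hsq]; field_simp
    have hsq_mem : ∀ i : ℕ, i ≤ n → 0 ≤ sq i ∧ sq i ≤ t := by
      intro i hi
      have hiR : (i : ℝ) ≤ n := by exact_mod_cast hi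
      refine ⟨by positivity, ?_⟩
      rw [hsq, div_le_iff₀ hnR]
      nlinarith
    have hsqT : ∀ i : ℕ, i ≤ n → sq i ^ 2 ≤ T := by
      intro i hi
      obtain ⟨h0, h1⟩ := hsq_mem i hi
      nlinarith
    -- telescoping
    have htel : E t - E 0 = ∑ i ∈ Finset.range n, (E (sq (i + 1)) - E (sq i)) := by
      rw [Finset.sum_range_sub (fun i => E (sq i)) n, hsqn, hsq0]
    -- each increment
    have hinc : ∀ i ∈ Finset.range n, -(2 * K * t ^ 2 * ((i : ℝ) + 1) / n ^ 2) ≤ E (sq (i + 1)) - E (sq i) := by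
      intro i hi
      have hi' : i + 1 ≤ n := Finset.mem_range.1 hi
      have h1 := hsec (sq (i + 1)) (sq i) (hsqT (i + 1) hi') (hsqT i (Nat.le_of_succ_le hi'))
      -- `E (sq i) - E (sq (i+1)) ≤ (sq i - sq (i+1)) * b (sq (i+1))`
      have hb := neg_mul_le_of_pointwise_lipschitz (K := K) (T := T) hlip hb0 (hsq_mem (i + 1) hi').1 (hsqT (i + 1) hi')
      have hsqi1 : sq (i + 1) = ((i : ℝ) + 1) * t / n := by simp [hsq]
      have hdiff : sq (i + 1) - sq i = t / n := by
        rw [hsqi1]; simp only [hsq]; field_simp; ring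
      have htn : 0 < t / n := div_pos ht hnR
      -- from h1: E(sq(i+1)) - E(sq i) ≥ (sq(i+1) - sq i) * b(sq(i+1))
      have h2 : (sq (i + 1) - sq i) * b (sq (i + 1)) ≤ E (sq (i + 1)) - E (sq i) := by nlinarith [h1]
      rw [hdiff] at h2
      have h3 : t / n * (-(2 * K * sq (i + 1))) ≤ t / n * b (sq (i + 1)) :=
        mul_le_mul_of_nonneg_left hb htn.le
      have h4 : t / n * (-(2 * K * sq (i + 1))) = -(2 * K * t ^ 2 * ((i : ℝ) + 1) / n ^ 2) := by
        rw [hsqi1]; field_simp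
      linarith [h3, h4, h2]
    have hsum := Finset.sum_le_sum hinc
    rw [← htel] at hsum
    -- evaluate the left sum: `Σ_{i<n} (i+1) = n(n+1)/2`
    have hid : ∀ m : ℕ, ∑ i ∈ Finset.range m, ((i : ℝ) + 1) = (m : ℝ) * (m + 1) / 2 := by
      intro m
      induction m with
      | zero => simp
      | succ m ih => rw [Finset.sum_range_succ, ih]; push_cast; ring
    have hleft : ∑ i ∈ Finset.range n, -(2 * K * t ^ 2 * ((i : ℝ) + 1) / n ^ 2) = -(K * t ^ 2 * (1 + 1 / n)) := by
      have : ∑ i ∈ Finset.range n, -(2 * K * t ^ 2 * ((i : ℝ) + 1) / n ^ 2) =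
          -(2 * K * t ^ 2 / n ^ 2) * ∑ i ∈ Finset.range n, ((i : ℝ) + 1) := by
        rw [Finset.mul_sum]
        refine Finset.sum_congr rfl fun i _ => ?_
        ring
      rw [this, hid n]
      field_simp
    linarith [hsum, hleft]
  -- let `n → ∞`
  by_contra hlt
  push Not at hlt
  -- gap `g = E 0 - K t² - E t > 0`; pick `n` with `K t² / n < g`
  set g := E 0 - K * t ^ 2 - E t with hg
  have hgpos : 0 < g := by rw [hg]; linarith
  obtain ⟨n, hn⟩ := exists_nat_gt (K * t ^ 2 / g)
  have hnpos : 0 < n := by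
    have : (0 : ℝ) < n := lt_of_le_of_lt (by positivity) hn
    exact_mod_cast this
  have hnR : (0 : ℝ) < n := by exact_mod_cast hnpos
  have h := hstep n hnpos
  have hKn : K * t ^ 2 / n < g := by
    rw [div_lt_iff₀ hnR]
    rw [div_lt_iff₀ hgpos] at hn
    linarith
  have : K * t ^ 2 * (1 + 1 / n) = K * t ^ 2 + K * t ^ 2 / n := by ring
  rw [this] at h
  linarith

/-- **Route A endgame for S3 (sharp constant).** Let `E, b : ℝ → ℝ` satisfy, on the window `s² ≤ T`: the secant bound
`E s″ − E s ≤ (s″ − s)·b s`, the pointwise Lipschitz bound `|b s″ − b s| ≤ (2K+ε)|s″ − s|` for `s″` near every `s`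
(every `ε > 0`), and `b 0 = 0`.  Then `E 0 − K t² ≤ E t` for every `t² ≤ T` — the conclusion of `stub_modulationBootstrap`
(with `E(t) ≤ E_w(Ψ) + t⟨V⟩_Ψ` by definition of the infimum), sharp constant, no uniformity of Poincaré constants in `s`.
[folklore: real induction / Dini mean value theorem] -/
theorem quadratic_lower_bound_of_secant {E b : ℝ → ℝ} {K T : ℝ} (hK : 0 ≤ K)
    (hsec : ∀ s s'' : ℝ, s ^ 2 ≤ T → s'' ^ 2 ≤ T → E s'' - E s ≤ (s'' - s) * b s)
    (hlip : ∀ s : ℝ, s ^ 2 ≤ T → ∀ ε : ℝ, 0 < ε →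
      ∀ᶠ s'' in 𝓝 s, s'' ^ 2 ≤ T → |b s'' - b s| ≤ (2 * K + ε) * |s'' - s|)
    (hb0 : b 0 = 0) (t : ℝ) (htT : t ^ 2 ≤ T) : E 0 - K * t ^ 2 ≤ E t := by
  rcases lt_trichotomy t 0 with ht | rfl | ht
  · -- reflect: `E' x = E (-x)`, `b' x = - b (-x)`
    have key := quadratic_lower_bound_of_secant_pos (E := fun x => E (-x)) (b := fun x => -b (-x)) (K := K) (T := T) hK
      (fun s s'' hs hs'' => by
        have h := hsec (-s) (-s'') (by simpa using hs) (by simpa using hs'')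
        show E (-s'') - E (-s) ≤ (s'' - s) * -b (-s)
        have e : (-s'' - -s) * b (-s) = (s'' - s) * -b (-s) := by ring
        rw [e] at h
        exact h)
      (fun s hs ε hε => by
        have hev := hlip (-s) (by simpa using hs) ε hε
        have hneg : Tendsto (fun x : ℝ => -x) (𝓝 s) (𝓝 (-s)) := (continuous_neg.tendsto s)
        filter_upwards [hneg.eventually hev] with s'' hs'' hT''
        have h1 := hs'' (by simpa using hT'')
        have e1 : b (-s'') - b (-s) = -((-b (-s'')) - (-b (-s))) := by ring
        have e2 : (-s'') - (-s) = -(s'' - s) := by ring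
        rw [e1, e2, abs_neg, abs_neg] at h1
        exact h1)
      (by simp [hb0]) (t := -t) (by linarith) (by simpa using htT)
    simpa using key
  · simp
  · exact quadratic_lower_bound_of_secant_pos hK hsec hlip hb0 ht htT

end Summit.AtomisticToContinuum.BoseEinsteinCondensation.Theorems.StaticResponseBound.Negative.UvThomsonG3
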